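import Literature.NumberTheory.LFunctions.SinnottGammaTransform
import Literature.NumberTheory.LFunctions.SinnottTeichmuller
import Mathlib.Algebra.MonoidAlgebra.Basic
import Mathlib.Algebra.Polynomial.AlgebraMap
import Mathlib.Algebra.Polynomial.Eval.Degree
import HarnessLib

/-!
# Sinnott's Theorem 3.2, algebraization at a finite level (`Γ`-transforms of `f/g`)

Topic `Literature/NumberTheory/LFunctions`; namespace `Literature.NumberTheory.LFunctions.Sinnott1987`.
THEOREMS ONLY (auxiliary `def`s with bodies; no named facts).

The setting of W. Sinnott, *On a theorem of L. Washington*, Astérisque 147–148 (1987), §3, for a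
**rational function measure**: two fields `F ⊆ E` of characteristic `p` with `F ⊆ 𝔽_q`
(`c^q = c` on `F`), the tower prime `M ≠ p`, and `φ = f/g` (`f, g ∈ F[X]`) evaluated on the
`M`-power roots of unity of `E` (`ratFn`).  From the finite Lemma 3.6 and the class-inversion
formula (file `SinnottGammaTransform`) we get, for a character `ψ` of `(ℤ/M^m)ˣ` with kernel `V` and
`Γ_α(ψ) = 0`, a primitive `M^m`-th root of unity `w` with
`G_y(w) := ∑_{η ∈ V} R_{η y}(w^{1/η}) = 0` (`Gsum`, `exists_isPrimitiveRoot_Gsum_eq_zero`; this is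
Sinnott's (3.12) `β̂_y(w) = 0`).  Clearing denominators, `G_y(w) · D(w)` is the value at `w` of a
fixed element `P_y` (`Pelem`) of the group algebra `F[ℤ_M]` under `[a] ↦ w^a` (`evalAt`), and
Sinnott's Theorem 2.2 (file `SinnottPowerFunctions`) shows that `P_y ≠ 0` forces `G_y(w) ≠ 0` for
all `w` of large level (`exists_level_gammaTransform_ne_zero_of_Pelem_ne_zero`).  The proof that
some `P_y ≠ 0` (Sinnott's use of Corollary 2.4 and the Appendix) is in the sequel file.

## References

* W. Sinnott, *On a theorem of L. Washington*, Astérisque 147–148 (1987), 209–224, §3.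
  [Sinnott1987]
-/

noncomputable section

open Finset Polynomial

namespace Literature.NumberTheory.LFunctions.Sinnott1987

/-! ### Clearing denominators -/

section Cleared

variable {ι A : Type*} [CommRing A] [DecidableEq ι]

/-- `∑_i n_i ∏_{i' ≠ i} d_{i'}`: the numerator of `∑_i n_i / d_i` over the common denominator
`∏_i d_i`. [folklore] -/
def clearedSum (s : Finset ι) (n d : ι → A) : A := ∑ i ∈ s, n i * ∏ i' ∈ s.erase i, d i'

/-- Under a ring map to a field killing no denominator, `clearedSum` is `(∑ n_i/d_i) ∏ d_i`.
[folklore] -/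
theorem map_clearedSum {K : Type*} [Field K] (χ : A →+* K) (s : Finset ι) (n d : ι → A)
    (hd : ∀ i ∈ s, χ (d i) ≠ 0) :
    χ (clearedSum s n d) = (∑ i ∈ s, χ (n i) / χ (d i)) * ∏ i ∈ s, χ (d i) := by
  rw [clearedSum, map_sum, sum_mul]
  refine sum_congr rfl fun i hi ↦ ?_
  rw [map_mul, map_prod, ← Finset.mul_prod_erase s (fun i' ↦ χ (d i')) hi]
  field_simp [hd i hi]

end Cleared

/-! ### The rational function `f/g` over `F` evaluated in `E ⊇ F` -/

section RatFn

variable {F E : Type*} [Field F] [Field E] [Algebra F E]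

/-- `φ = f/g` evaluated in `E`: `ratFn f g x = f(x)/g(x)`. [cite: Sinnott1987, §1.16] -/
def ratFn (f g : F[X]) (x : E) : E := f.eval₂ (algebraMap F E) x / g.eval₂ (algebraMap F E) x

/-- Unfolding `ratFn`. [folklore] -/
theorem ratFn_def (f g : F[X]) (x : E) :
    ratFn f g x = f.eval₂ (algebraMap F E) x / g.eval₂ (algebraMap F E) x := rfl

variable {p : ℕ} [Fact p.Prime] [CharP E p]

/-- **Frobenius equivariance of evaluation**: `f(x)^q = f(x^q)` for `f ∈ F[X]`, `F ⊆ 𝔽_q`.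
[folklore] -/
theorem eval₂_pow_eq {q d : ℕ} (hqd : q = p ^ d) (hF : ∀ c : F, c ^ q = c) (P : F[X]) (x : E) :
    (P.eval₂ (algebraMap F E) x) ^ q = P.eval₂ (algebraMap F E) (x ^ q) := by
  have hfr : ∀ y : E, y ^ q = iterateFrobenius E p d y := fun y ↦ by rw [iterateFrobenius_def, hqd]
  rw [hfr, Polynomial.hom_eval₂, ← hfr]
  congr 1
  ext c
  rw [RingHom.comp_apply, ← hfr, ← map_pow, hF]

/-- **`φ = f/g` is Frobenius-equivariant**: `φ(x)^q = φ(x^q)`. [cite: Sinnott1987, §1.16] -/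
theorem ratFn_pow_eq {q d : ℕ} (hqd : q = p ^ d) (hF : ∀ c : F, c ^ q = c) (f g : F[X]) (x : E) :
    ratFn f g x ^ q = ratFn f g (x ^ q) := by
  rw [ratFn_def, ratFn_def, div_pow, eval₂_pow_eq hqd hF, eval₂_pow_eq hqd hF]

end RatFn

/-! ### From Lemma 3.6 to `β̂_y(w) = 0` (Sinnott's (3.11)–(3.12)) -/

section Link

variable {E : Type*} [Field E] {M : ℕ} [hM : Fact M.Prime] {p : ℕ} [hp : Fact p.Prime] [CharP E p]

/-- `depth M ≤ v_M(q - 1)` for a good modulus. [folklore] -/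
theorem depth_le_of_goodModulus {q : ℕ} (hq : GoodModulus M q) {n₀ : ℕ}
    (hn₀ : padicValNat M (q - 1) = n₀) : depth M ≤ n₀ := by
  rw [← hn₀]
  unfold depth; split_ifs with h2
  · subst h2
    have hq1 : q - 1 ≠ 0 := by have := hq.one_lt; omega
    have : 2 ^ 2 ∣ q - 1 := by norm_num; exact hq.four_dvd rfl
    exact (padicValNat_dvd_iff_le hq1).mp this
  · exact hq.one_le_padicValNat

/-- **`G_y(w) := ∑_{η ∈ V} R_{ηy}(w^{1/η})`** — Sinnott's `β̂_y` as a function of a root of unity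
`w` of level `m`: `R_a = Rfun ε φ a`, `a = η y mod M^{n₀}`, `w^{1/η} = torsionPow m w η⁻¹`.
[cite: Sinnott1987, (3.11)–(3.12)] -/
def Gsum (n₀ m : ℕ) (ε : E) (φ : E → E) (y : ℤ_[M]ˣ) (w : E) : E :=
  ∑ η ∈ teich M, Rfun ε φ (PadicInt.toZModPow n₀ ((η * y : ℤ_[M]ˣ) : ℤ_[M]))
    (torsionPow m w ((η⁻¹ : ℤ_[M]ˣ) : ℤ_[M]))

omit hp [CharP E p] in
/-- Unfolding `Gsum`. [folklore] -/
theorem Gsum_def (n₀ m : ℕ) (ε : E) (φ : E → E) (y : ℤ_[M]ˣ) (w : E) :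
    Gsum n₀ m ε φ y w = ∑ η ∈ teich M, Rfun ε φ (PadicInt.toZModPow n₀ ((η * y : ℤ_[M]ˣ) : ℤ_[M]))
      (torsionPow m w ((η⁻¹ : ℤ_[M]ˣ) : ℤ_[M])) := rfl

omit hp [CharP E p] in
/-- `Gsum` is the same for any primitive `M^{n₀}`-th root of unity `ε`. [folklore] -/
theorem Gsum_eq_of_isPrimitiveRoot {n₀ : ℕ} (m : ℕ) {ε ε' : E} (hε : IsPrimitiveRoot ε (M ^ n₀))
    (hε' : IsPrimitiveRoot ε' (M ^ n₀)) (φ : E → E) (y : ℤ_[M]ˣ) (w : E) :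
    Gsum n₀ m ε' φ y w = Gsum n₀ m ε φ y w := by
  rw [Gsum_def, Gsum_def]
  exact sum_congr rfl fun η _ ↦ Rfun_eq_of_isPrimitiveRoot hε hε' φ _ _

omit hp [CharP E p] in
/-- `toZModPow n₀ (η y) = (redUnits (n₀+r) η · redUnits (n₀+r) y) mod M^{n₀}`. [folklore] -/
theorem toZModPow_eq_castDown {n₀ r : ℕ} (x : ℤ_[M]) :
    PadicInt.toZModPow n₀ x = castDown n₀ r (PadicInt.toZModPow (n₀ + r) x) := by
  rw [ZMod.castHom_apply, PadicInt.cast_toZModPow n₀ (n₀ + r) (Nat.le_add_right n₀ r)]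

/-- **From `Γ_α(ψ) = 0` to `β̂_y(w) = 0`**: under the hypotheses of Lemma 3.6 (level `n₀ + r`,
`r ≥ n₀`), for every `y ∈ ℤ_Mˣ` there is a primitive `M^{n₀+r}`-th root of unity `w` with
`G_y(w) = 0`. [cite: Sinnott1987, (3.11)–(3.12)] -/
theorem exists_isPrimitiveRoot_Gsum_eq_zero (hMp : M ≠ p) {q d : ℕ} (hqd : q = p ^ d)
    (hq : GoodModulus M q) {n₀ r : ℕ} (hn₀ : padicValNat M (q - 1) = n₀) (hr : n₀ ≤ r)
    {ζ : E} (hζ : IsPrimitiveRoot ζ (M ^ (n₀ + r))) {φ : E → E}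
    (hφ : ∀ x : E, x ^ M ^ (n₀ + r) = 1 → φ x ^ q = φ (x ^ q))
    {ψ : (ZMod (M ^ (n₀ + r)))ˣ →* Eˣ} (hK1 : ∀ v, IsTors v → ψ v = 1)
    (hK2 : ∀ u, ψ u = 1 → IsTors u) (hΓ : gammaTransform ζ φ ψ = 0) (y : ℤ_[M]ˣ) :
    ∃ w : E, IsPrimitiveRoot w (M ^ (n₀ + r)) ∧ Gsum n₀ (n₀ + r) (ζ ^ M ^ r) φ y w = 0 := by
  classical
  have hMF : (M : E) ≠ 0 := fun h ↦ hMp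
    ((Nat.prime_dvd_prime_iff_eq hp.out hM.out).mp ((CharP.cast_eq_zero_iff E p M).mp h)).symm
  have hn1 : 1 ≤ n₀ := hn₀ ▸ hq.one_le_padicValNat
  have hd : depth M ≤ n₀ := depth_le_of_goodModulus hq hn₀
  have hζ1 := hζ.pow_eq_one
  obtain ⟨e₀, he₀⟩ := lemma36 hMp hqd hq hn₀ rfl hr hζ hφ hK1 hK2 hΓ
  set yb : (ZMod (M ^ (n₀ + r)))ˣ := redUnits (n₀ + r) y with hyb
  set w : E := pw ζ ((e₀ * yb⁻¹ : (ZMod (M ^ (n₀ + r)))ˣ) : ZMod (M ^ (n₀ + r))) with hw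
  refine ⟨w, ?_, ?_⟩
  · rw [hw, pw_def]
    exact hζ.pow_of_coprime _ (ZMod.val_coe_unit_coprime _)
  · have h := he₀ yb
    -- the summand as a function of the reduced torsion unit
    set G : (ZMod (M ^ (n₀ + r)))ˣ → E := fun v ↦
      Rfun (ζ ^ M ^ r) φ (castDown n₀ r ((v * yb : (ZMod (M ^ (n₀ + r)))ˣ) : ZMod (M ^ (n₀ + r))))
        (w ^ (((v⁻¹ : (ZMod (M ^ (n₀ + r)))ˣ) : ZMod (M ^ (n₀ + r)))).val) with hG
    have hsummand : ∀ η ∈ teich M,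
        Rfun (ζ ^ M ^ r) φ (PadicInt.toZModPow n₀ ((η * y : ℤ_[M]ˣ) : ℤ_[M]))
          (torsionPow (n₀ + r) w ((η⁻¹ : ℤ_[M]ˣ) : ℤ_[M])) = G (redUnits (n₀ + r) η) := by
      intro η _
      simp only [hG]
      rw [torsionPow_def, ← coe_redUnits_inv, toZModPow_eq_castDown (n₀ := n₀) (r := r),
        Units.val_mul, map_mul, ← coe_redUnits, ← coe_redUnits, ← hyb, ← Units.val_mul]
    rw [Gsum_def, sum_congr rfl hsummand, ← sum_filter_isTors_eq_sum_teich (le_trans hd (by omega)) G]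
    -- now compare with Lemma 3.6 at `yb`
    rw [← h]
    simp only [torsSum_def, mul_sum]
    rw [sum_comm]
    refine sum_congr rfl fun v _ ↦ ?_
    -- class inversion with `a = v yb`, `b = e₀ (v yb)⁻¹`
    have hcl := sum_filter_congOne_pw_mul_levelMeasure hMF hζ hn1 φ (v * yb)
      ((e₀ * (v * yb)⁻¹ : (ZMod (M ^ (n₀ + r)))ˣ) : ZMod (M ^ (n₀ + r)))
    have hlhs : ∀ t : (ZMod (M ^ (n₀ + r)))ˣ,
        pw ζ ((e₀ * t : (ZMod (M ^ (n₀ + r)))ˣ) : ZMod (M ^ (n₀ + r))) *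
          levelMeasure ζ φ ((v * (t * yb) : (ZMod (M ^ (n₀ + r)))ˣ) : ZMod (M ^ (n₀ + r))) =
        pw ζ (((e₀ * (v * yb)⁻¹ : (ZMod (M ^ (n₀ + r)))ˣ) : ZMod (M ^ (n₀ + r))) *
            ((v * yb * t : (ZMod (M ^ (n₀ + r)))ˣ) : ZMod (M ^ (n₀ + r)))) *
          levelMeasure ζ φ ((v * yb * t : (ZMod (M ^ (n₀ + r)))ˣ) : ZMod (M ^ (n₀ + r))) := by
      intro t
      congr 2
      · rw [← Units.val_mul]; congr 1; group
      · congr 1; rw [mul_assoc, mul_comm t]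
    simp_rw [hlhs]
    rw [hcl]
    simp only [hG]
    congr 1
    rw [hw, ← pw_mul hζ1]
    congr 1
    rw [mul_inv_rev]
    push_cast
    ring

end Link

/-! ### The group algebra `F[ℤ_M]`, evaluation at a root of unity, and the element `P_y` -/

section GroupAlgebra

variable {F E : Type*} [Field F] [Field E] [Algebra F E] {M : ℕ} [hM : Fact M.Prime]

/-- Classical decidable equality on `ℤ_Mˣ` (there is no computable instance); fixed once so that
all `Finset` operations on `ℤ_Mˣ` use the same instance. [folklore] -/
instance instDecidableEqPadicIntUnits : DecidableEq ℤ_[M]ˣ := Classical.decEq _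

/-- `a ↦ w^a` as a monoid hom `ℤ_M → E` (for `w^{M^m} = 1`). [cite: Sinnott1987, §2.1, Corollary 2.4] -/
def torsionPowHom (m : ℕ) {w : E} (hw : w ^ M ^ m = 1) : Multiplicative ℤ_[M] →* E where
  toFun a := torsionPow m w (Multiplicative.toAdd a)
  map_one' := by simp
  map_mul' a b := by rw [toAdd_mul, ← torsionPow_add hw]

/-- **Evaluation at `w`**: the `F`-algebra hom `F[ℤ_M] → E`, `[a] ↦ w^a` (Sinnott's map `h` of
Corollary 2.4 followed by evaluation). [cite: Sinnott1987, Corollary 2.4] -/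
def evalAt (m : ℕ) {w : E} (hw : w ^ M ^ m = 1) : AddMonoidAlgebra F ℤ_[M] →ₐ[F] E :=
  AddMonoidAlgebra.lift F E ℤ_[M] (torsionPowHom m hw)

/-- `evalAt` on a monomial. [folklore] -/
theorem evalAt_single (m : ℕ) {w : E} (hw : w ^ M ^ m = 1) (a : ℤ_[M]) (c : F) :
    evalAt m hw (AddMonoidAlgebra.single a c) = algebraMap F E c * torsionPow m w a := by
  rw [evalAt, AddMonoidAlgebra.lift_single, Algebra.smul_def]; rfl

/-- `evalAt` as a power sum over the support. [folklore] -/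
theorem evalAt_apply (m : ℕ) {w : E} (hw : w ^ M ^ m = 1) (P : AddMonoidAlgebra F ℤ_[M]) :
    evalAt m hw P = ∑ a ∈ P.coeff.support, algebraMap F E (P.coeff a) * torsionPow m w a := by
  rw [evalAt, AddMonoidAlgebra.lift_apply']; rfl

/-- **Substitution `X ↦ [η⁻¹]`**: `F[X] → F[ℤ_M]` (Sinnott's `Y_j = ∏ X_i^{c_ij}` with
`h(Y_j) = z^{1/η_j}`). [cite: Sinnott1987, proof of Theorem 3.2] -/
def substInv (η : ℤ_[M]ˣ) : F[X] →ₐ[F] AddMonoidAlgebra F ℤ_[M] :=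
  Polynomial.aeval (AddMonoidAlgebra.single ((η⁻¹ : ℤ_[M]ˣ) : ℤ_[M]) (1 : F))

/-- `evalAt ∘ substInv η` is evaluation of the polynomial at `w^{1/η}`. [folklore] -/
theorem evalAt_substInv (m : ℕ) {w : E} (hw : w ^ M ^ m = 1) (η : ℤ_[M]ˣ) (P : F[X]) :
    evalAt m hw (substInv η P) = P.eval₂ (algebraMap F E) (torsionPow m w ((η⁻¹ : ℤ_[M]ˣ) : ℤ_[M])) := by
  rw [substInv, ← Polynomial.aeval_algHom_apply, evalAt_single, map_one, one_mul, Polynomial.aeval_def]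

variable {n₀ : ℕ}

/-- The numerator polynomial `M^{-n₀} ε^{-ja} f(ε^j X)`. [cite: Sinnott1987, proof of Theorem 3.2] -/
def numPoly (n₀ : ℕ) (ε₁ : F) (f : F[X]) (a j : ZMod (M ^ n₀)) : F[X] :=
  C (((M ^ n₀ : ℕ) : F)⁻¹ * pw ε₁ (-(j * a))) * f.comp (C (pw ε₁ j) * X)

/-- The denominator polynomial `g(ε^j X)`. [cite: Sinnott1987, proof of Theorem 3.2] -/
def denPoly (n₀ : ℕ) (ε₁ : F) (g : F[X]) (j : ZMod (M ^ n₀)) : F[X] := g.comp (C (pw ε₁ j) * X)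

omit hM in
/-- Evaluation of `numPoly`. [folklore] -/
theorem eval₂_numPoly (ε₁ : F) (f : F[X]) (a j : ZMod (M ^ n₀)) (x : E) :
    (numPoly n₀ ε₁ f a j).eval₂ (algebraMap F E) x =
      algebraMap F E (((M ^ n₀ : ℕ) : F)⁻¹ * pw ε₁ (-(j * a))) *
        f.eval₂ (algebraMap F E) (pw (algebraMap F E ε₁) j * x) := by
  rw [numPoly, eval₂_mul, eval₂_C, eval₂_comp, eval₂_mul, eval₂_C, eval₂_X, pw_def, pw_def, pw_def,
    map_pow]

omit hM in
/-- Evaluation of `denPoly`. [folklore] -/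
theorem eval₂_denPoly (ε₁ : F) (g : F[X]) (j : ZMod (M ^ n₀)) (x : E) :
    (denPoly n₀ ε₁ g j).eval₂ (algebraMap F E) x =
      g.eval₂ (algebraMap F E) (pw (algebraMap F E ε₁) j * x) := by
  rw [denPoly, eval₂_comp, eval₂_mul, eval₂_C, eval₂_X, pw_def, pw_def, map_pow]

/-- The index set `V × ℤ/M^{n₀}`. [folklore] -/
def idx (M n₀ : ℕ) [Fact M.Prime] : Finset (ℤ_[M]ˣ × ZMod (M ^ n₀)) := (teich M) ×ˢ univ

/-- **The element `P_y ∈ F[ℤ_M]`** whose value at `w` is `G_y(w) · ∏ g(ε^j w^{1/η})`: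
`P_y = ∑_{(η,j)} [η⁻¹](numPoly) ∏_{(η',j') ≠ (η,j)} [η'⁻¹](denPoly)`.
[cite: Sinnott1987, proof of Theorem 3.2 (the element `F(X₁,…,X_n)` with `h(F) = β̂_y`)] -/
def Pelem (n₀ : ℕ) (ε₁ : F) (f g : F[X]) (y : ℤ_[M]ˣ) : AddMonoidAlgebra F ℤ_[M] :=
  clearedSum (idx M n₀)
    (fun ij ↦ substInv ij.1 (numPoly n₀ ε₁ f (PadicInt.toZModPow n₀ ((ij.1 * y : ℤ_[M]ˣ) : ℤ_[M])) ij.2))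
    (fun ij ↦ substInv ij.1 (denPoly n₀ ε₁ g ij.2))

/-- **`evalAt w (P_y) = G_y(w) · D(w)`** when no denominator `g(ε^j w^{1/η})` vanishes.
[cite: Sinnott1987, proof of Theorem 3.2] -/
theorem evalAt_Pelem (m : ℕ) {w : E} (hw : w ^ M ^ m = 1) (ε₁ : F) (f g : F[X]) (y : ℤ_[M]ˣ)
    (hden : ∀ ij ∈ idx M n₀, (denPoly n₀ ε₁ g ij.2).eval₂ (algebraMap F E)
      (torsionPow m w ((ij.1⁻¹ : ℤ_[M]ˣ) : ℤ_[M])) ≠ 0) :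
    evalAt m hw (Pelem n₀ ε₁ f g y) =
      Gsum n₀ m (algebraMap F E ε₁) (ratFn f g) y w *
        ∏ ij ∈ idx M n₀, (denPoly n₀ ε₁ g ij.2).eval₂ (algebraMap F E)
          (torsionPow m w ((ij.1⁻¹ : ℤ_[M]ˣ) : ℤ_[M])) := by
  classical
  set χ : AddMonoidAlgebra F ℤ_[M] →+* E := (evalAt (F := F) m hw).toRingHom with hχ
  have hχ' : ∀ P, evalAt (F := F) m hw P = χ P := fun P ↦ rfl
  have hden' : ∀ ij ∈ idx M n₀, χ (substInv ij.1 (denPoly n₀ ε₁ g ij.2)) ≠ 0 := by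
    intro ij hij
    rw [← hχ', evalAt_substInv]
    exact hden ij hij
  unfold Pelem
  rw [hχ', map_clearedSum χ _ _ _ hden']
  simp only [← hχ', evalAt_substInv]
  congr 1
  rw [Gsum_def, idx, sum_product]
  refine sum_congr rfl fun η _ ↦ ?_
  rw [Rfun_def, mul_sum]
  refine sum_congr rfl fun j _ ↦ ?_
  rw [eval₂_numPoly, eval₂_denPoly, ratFn_def, map_mul, map_inv₀, map_natCast, pw_def ε₁, map_pow,
    ← pw_def]
  ring

end GroupAlgebra

/-! ### Large levels: Theorem 2.2 applied to `P_y` and to `g` -/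

section Levels

variable {F E : Type*} [Field F] [Field E] [Algebra F E] {M : ℕ} [hM : Fact M.Prime]
  {p : ℕ} [hp : Fact p.Prime] [CharP E p]

/-- `torsionPow m x i = x^i` for a natural number `i` (`x^{M^m} = 1`). [folklore] -/
theorem torsionPow_natCast {m : ℕ} {x : E} (hx : x ^ M ^ m = 1) (i : ℕ) :
    torsionPow m x (i : ℤ_[M]) = x ^ i := by
  rw [torsionPow_def, map_natCast, ZMod.val_natCast]
  exact pow_eq_pow_of_modEq hx (Nat.mod_modEq _ _)

/-- **A nonzero element of `F[ℤ_M]` does not vanish at roots of unity of large level**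
(Sinnott's Theorem 2.2 / Corollary 2.4 for `P`). [cite: Sinnott1987, Theorem 2.2, Corollary 2.4] -/
theorem exists_level_evalAt_ne_zero (hMp : M ≠ p) {q d : ℕ} (hqd : q = p ^ d) (hq : GoodModulus M q)
    (hF : ∀ c : F, c ^ q = c) {P : AddMonoidAlgebra F ℤ_[M]} (hP : P ≠ 0) :
    ∃ s₀, ∀ m, s₀ ≤ m → ∀ (w : E) (hw : IsPrimitiveRoot w (M ^ m)), evalAt m hw.pow_eq_one P ≠ 0 := by
  classical
  obtain ⟨s₀, hs₀⟩ := exists_level_eq_zero_of_sum_mul_torsionPow_eq_zero (F := E) hMp hqd hq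
    P.coeff.support (fun a : ℤ_[M] ↦ a) (Set.injOn_id _)
  refine ⟨s₀, fun m hm w hw h ↦ ?_⟩
  rw [evalAt_apply] at h
  have hall := hs₀ (fun a ↦ algebraMap F E (P.coeff a)) (fun a _ ↦ by rw [← map_pow, hF]) m hm w hw h
  obtain ⟨a, ha⟩ : P.coeff.support.Nonempty := by
    rw [Finsupp.support_nonempty_iff, ne_eq, AddMonoidAlgebra.coeff_eq_zero]; exact hP
  have := hall a ha
  rw [map_eq_zero] at this
  exact (Finsupp.mem_support_iff.mp ha) this

/-- **A nonzero polynomial does not vanish at roots of unity of large level** (Theorem 2.2 for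
`g`). [cite: Sinnott1987, Theorem 2.2] -/
theorem exists_level_eval₂_ne_zero (hMp : M ≠ p) {q d : ℕ} (hqd : q = p ^ d) (hq : GoodModulus M q)
    (hF : ∀ c : F, c ^ q = c) {g : F[X]} (hg : g ≠ 0) :
    ∃ s₀, ∀ m, s₀ ≤ m → ∀ x : E, IsPrimitiveRoot x (M ^ m) → g.eval₂ (algebraMap F E) x ≠ 0 := by
  classical
  obtain ⟨s₀, hs₀⟩ := exists_level_eq_zero_of_sum_mul_torsionPow_eq_zero (F := E) hMp hqd hq
    g.support (fun i : ℕ ↦ (i : ℤ_[M])) (fun i _ j _ h ↦ Nat.cast_injective h)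
  refine ⟨s₀, fun m hm x hx h ↦ ?_⟩
  have hsum : ∑ i ∈ g.support, algebraMap F E (g.coeff i) * torsionPow m x (i : ℤ_[M]) = 0 := by
    rw [← h, eval₂_eq_sum, Polynomial.sum_def]
    exact sum_congr rfl fun i _ ↦ by rw [torsionPow_natCast hx.pow_eq_one]
  have hall := hs₀ (fun i ↦ algebraMap F E (g.coeff i)) (fun i _ ↦ by rw [← map_pow, hF]) m hm x hx hsum
  obtain ⟨i, hi⟩ : g.support.Nonempty := Polynomial.support_nonempty.mpr hg
  have := hall i hi
  rw [map_eq_zero] at this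
  exact (Polynomial.mem_support_iff.mp hi) this

/-- The product of a primitive `M^m`-th root of unity and an `M^{n₀}`-th root of unity, `n₀ < m`,
is a primitive `M^m`-th root of unity. [folklore] -/
theorem isPrimitiveRoot_mul_of_pow_eq_one {m n₀ : ℕ} (hn : n₀ < m) {x u : E}
    (hx : IsPrimitiveRoot x (M ^ m)) (hu : u ^ M ^ n₀ = 1) : IsPrimitiveRoot (u * x) (M ^ m) := by
  obtain ⟨k, rfl⟩ : ∃ k, m = k + 1 := ⟨m - 1, by omega⟩
  have hu' : u ^ M ^ k = 1 := by
    obtain ⟨c, hc⟩ : M ^ n₀ ∣ M ^ k := pow_dvd_pow M (by omega)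
    rw [hc, pow_mul, hu, one_pow]
  have hfin : (u * x) ^ M ^ (k + 1) = 1 := by
    rw [mul_pow, hx.pow_eq_one, pow_succ, pow_mul, hu', one_pow, one_mul]
  have hnot : ¬ (u * x) ^ M ^ k = 1 := by
    intro h
    rw [mul_pow, hu', one_mul] at h
    have := hx.pow_eq_one_iff_dvd (M ^ k) |>.mp h
    have := Nat.le_of_dvd (pow_pos hM.out.pos _) this
    have := Nat.pow_lt_pow_right hM.out.one_lt (by omega : k < k + 1)
    omega
  rw [← orderOf_eq_prime_pow hnot hfin]
  exact IsPrimitiveRoot.orderOf _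

/-- `w^{1/η}` is a primitive `M^m`-th root of unity for `η ∈ ℤ_Mˣ`. [folklore] -/
theorem isPrimitiveRoot_torsionPow_inv {m : ℕ} {w : E} (hw : IsPrimitiveRoot w (M ^ m)) (η : ℤ_[M]ˣ) :
    IsPrimitiveRoot (torsionPow m w ((η⁻¹ : ℤ_[M]ˣ) : ℤ_[M])) (M ^ m) := by
  rw [torsionPow_def, ← coe_redUnits_inv]
  exact hw.pow_of_coprime _ (ZMod.val_coe_unit_coprime _)

variable {n₀ : ℕ}

/-- **If `P_y ≠ 0` then `G_y(w) ≠ 0` for all `w` of large level.**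
[cite: Sinnott1987, proof of Theorem 3.2 ("`h(F)` is not a unit … so `F = 0`")] -/
theorem exists_level_Gsum_ne_zero (hMp : M ≠ p) {q d : ℕ} (hqd : q = p ^ d) (hq : GoodModulus M q)
    (hF : ∀ c : F, c ^ q = c) {ε₁ : F} (hε₁ : ε₁ ^ M ^ n₀ = 1) {f g : F[X]} (hg : g ≠ 0)
    {y : ℤ_[M]ˣ} (hPy : Pelem n₀ ε₁ f g y ≠ 0) :
    ∃ s₁, ∀ m, s₁ ≤ m → ∀ w : E, IsPrimitiveRoot w (M ^ m) →
      Gsum n₀ m (algebraMap F E ε₁) (ratFn f g) y w ≠ 0 := by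
  classical
  obtain ⟨s₀, hs₀⟩ := exists_level_evalAt_ne_zero (E := E) hMp hqd hq hF hPy
  obtain ⟨sg, hsg⟩ := exists_level_eval₂_ne_zero (E := E) hMp hqd hq hF hg
  refine ⟨max s₀ (max sg (n₀ + 1)), fun m hm w hw hG ↦ ?_⟩
  have hden : ∀ ij ∈ idx M n₀, (denPoly n₀ ε₁ g ij.2).eval₂ (algebraMap F E)
      (torsionPow m w ((ij.1⁻¹ : ℤ_[M]ˣ) : ℤ_[M])) ≠ 0 := by
    intro ij _
    rw [eval₂_denPoly]
    refine hsg m (le_trans (le_max_left _ _) (le_trans (le_max_right _ _) hm)) _ ?_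
    refine isPrimitiveRoot_mul_of_pow_eq_one (n₀ := n₀)
      (lt_of_lt_of_le (Nat.lt_succ_self n₀) (le_trans (le_max_right _ _) (le_trans (le_max_right _ _) hm)))
      (isPrimitiveRoot_torsionPow_inv hw _) ?_
    rw [pw_def, ← pow_mul, mul_comm, pow_mul, ← map_pow, hε₁, map_one, one_pow]
  have h := evalAt_Pelem m hw.pow_eq_one ε₁ f g y hden
  rw [hG, zero_mul] at h
  exact hs₀ m (le_trans (le_max_left _ _) hm) w hw h

/-- **Main level theorem of this file.**  If `P_y ≠ 0` for some `y ∈ ℤ_Mˣ`, then for all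
large `m`, every primitive `M^m`-th root of unity `ζ` and every character `ψ` of `(ℤ/M^m)ˣ` with
kernel exactly `V`, the `Γ`-transform of the level measure of `φ = f/g` at `ψ` is nonzero.
[cite: Sinnott1987, Theorem 3.2 with Lemma 3.6] -/
theorem exists_level_gammaTransform_ne_zero_of_Pelem_ne_zero (hMp : M ≠ p) {q d : ℕ}
    (hqd : q = p ^ d) (hq : GoodModulus M q) (hF : ∀ c : F, c ^ q = c)
    (hn₀ : padicValNat M (q - 1) = n₀) {ε₁ : F} (hε₁ : IsPrimitiveRoot ε₁ (M ^ n₀))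
    {f g : F[X]} (hg : g ≠ 0) {y : ℤ_[M]ˣ} (hPy : Pelem n₀ ε₁ f g y ≠ 0) :
    ∃ m₀, ∀ m, m₀ ≤ m → ∀ ζ : E, IsPrimitiveRoot ζ (M ^ m) → ∀ ψ : (ZMod (M ^ m))ˣ →* Eˣ,
      (∀ v, IsTors v → ψ v = 1) → (∀ u, ψ u = 1 → IsTors u) →
        gammaTransform ζ (ratFn f g : E → E) ψ ≠ 0 := by
  obtain ⟨s₁, hs₁⟩ := exists_level_Gsum_ne_zero (E := E) hMp hqd hq hF hε₁.pow_eq_one hg hPy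
  refine ⟨max s₁ (2 * n₀), fun m hm ζ hζ ψ hK1 hK2 hΓ ↦ ?_⟩
  obtain ⟨r, rfl⟩ : ∃ r, m = n₀ + r := ⟨m - n₀, by omega⟩
  have hr : n₀ ≤ r := by omega
  obtain ⟨w, hw, hG⟩ := exists_isPrimitiveRoot_Gsum_eq_zero hMp hqd hq hn₀ hr hζ
    (fun x _ ↦ ratFn_pow_eq hqd hF f g x) hK1 hK2 hΓ y
  have hζr : IsPrimitiveRoot (ζ ^ M ^ r) (M ^ n₀) :=
    hζ.pow (pow_pos hM.out.pos _) (by rw [pow_add, mul_comm])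
  have hε : IsPrimitiveRoot (algebraMap F E ε₁) (M ^ n₀) :=
    hε₁.map_of_injective (algebraMap F E).injective
  rw [Gsum_eq_of_isPrimitiveRoot (n₀ + r) hε hζr] at hG
  exact hs₁ (n₀ + r) (le_trans (le_max_left _ _) hm) w hw hG

end Levels

end Literature.NumberTheory.LFunctions.Sinnott1987
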